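import Summits.NavierStokesRegularity.NavierStokesRegularity.Theorems.QuietScarPocketDoorDefs
import Literature.Analysis.FluidPDE.NSBoundedHigherRegularityQuantProofs
import Literature.Analysis.FluidPDE.ClassicalSuitableRegion
import Mathlib.Analysis.Calculus.UniformLimitsDeriv
import Mathlib.Analysis.SpecialFunctions.Pow.Continuity

/-!
# QuietScarPocketDoorTerminalTrace — door S31 «QuietScarPocketDoor», plate P1 part 2/2:
# **PF-a `terminalTraceC1_holds : TerminalTraceC1`** (ns-s29-p2 g3, DIRECTOR-NS #192 (2))

PF-a (texts of record `QuietScarPocketDoorDefs`, = nsreg-p1 g25 Sketch31 v2.1 363b5766493b6c28, ref3 g24 SEAL 09:36Z): a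
classical Navier–Stokes solution (`ν = 1`, no force) on `(a,0) × B(x_c,4r)` with `‖u‖ ≤ M` and `|p| ≤ P` there has a
terminal velocity trace `u₀` on `B(x_c,2r)`: `u₀` is differentiable, `u t → u₀` and `D_x(u t) → D_x u₀` UNIFORMLY on
`B(x_c,2r)` as `t ↑ 0`.

* §1 (pure topology; = nsreg-p1 g25's `r29/TraceSketch.lean` 762b55b06a32f03b, copied verbatim): an ε–δ / Hölder modulus
  in time near `0⁻` makes `(u t)` uniformly Cauchy along `𝓝[<] 0`; completeness gives the trace; uniform convergence of
  the derivatives + `hasFDerivAt_of_tendstoUniformlyOnFilter` makes it differentiable with the right derivative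
  (`exists_terminalTraceC1`).
* §2 (the Navier–Stokes input, BY NAME): `holder_moduli_of_classical` — Seregin–Šverák 2009 §2 higher interior regularity
  WITH the dependence of the norms on the data (`Literature.Analysis.FluidPDE.NSBoundedHigherRegularityBounds_holds`) applied
  on the backward parabolic cylinders `Q_{R₀}(0, x)`, `R₀ = min r √(−a)`, `x ∈ B(x_c,2r)`, whose VERTEX IS AT THE TERMINAL
  TIME (r29/PF-AID.md §B): the data are `M` and `P' = P^{3/2}·|Q_{R₀}|` for every centre, so the Hölder constants of
  `V` and `D_x V` on `Q_{R₀/2}(0,x)` are uniform in `x`; the representative `V` IS `u` on the inner cylinder (both jointly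
  continuous, `Measure.eqOn_open_of_ae_eq`), whence Hölder moduli in time for `u(·,x)` and `D_x u(·,x)` on
  `(−R₀²/4, 0) × B(x_c, 2r)`.
* §3 `terminalTraceC1_holds`.

The pressure bound is genuinely needed (Serrin's `a(t)∇φ` examples have no time regularity); it enters through the
`L^{3/2}` clause of the interior-regularity fact.

WHAT THIS IS NOT: the trace/derivative half of LEG F of door S31 only (analyticity of the trace is PF-b/PF-c); nothing
about door S31 itself, 0056 or NS regularity is proved here (0056 OPEN; S31 is a criterion door inside a hypothetical
Type-I blow-up).
-/

noncomputable section

set_option linter.dupNamespace false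

namespace Summit.NavierStokesRegularity.NavierStokesRegularity.Theorems.QuietScarPocketDoor

open MeasureTheory Set Function Filter Topology TopologicalSpace Metric
open scoped RealInnerProductSpace InnerProductSpace NNReal ENNReal Topology
open Literature.Analysis Literature.Analysis.FluidPDE

/-! ## §1 Pure topology: terminal traces from moduli of continuity in time (nsreg-p1 g25 `r29/TraceSketch.lean` 762b55b06a32f03b) -/

section Topology

variable {Y : Type*} {X : Type*} [NormedAddCommGroup X]

/-- ε–δ modulus in time near `0⁻` ⇒ uniformly Cauchy along `𝓝[<] 0`. -/
theorem uniformCauchySeqOn_nhdsLT_zero {S : Set Y} {F : ℝ → Y → X}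
    (hF : ∀ ε > (0 : ℝ), ∃ δ > (0 : ℝ), ∀ s ∈ Ioo (-δ) (0 : ℝ), ∀ t ∈ Ioo (-δ) (0 : ℝ),
      ∀ x ∈ S, dist (F t x) (F s x) < ε) :
    UniformCauchySeqOn F (𝓝[<] (0 : ℝ)) S := by
  intro u hu
  obtain ⟨ε, hε, hεu⟩ := Metric.mem_uniformity_dist.mp hu
  obtain ⟨δ, hδ, h⟩ := hF ε hε
  have hI : Ioo (-δ) (0 : ℝ) ∈ 𝓝[<] (0 : ℝ) := Ioo_mem_nhdsLT (by linarith)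
  filter_upwards [prod_mem_prod hI hI] with m hm x hx
  exact hεu (h m.2 hm.2 m.1 hm.1 x hx)

/-- Hölder modulus in time on `Ioo (-η) 0` ⇒ ε–δ modulus. -/
theorem epsDelta_of_holder_time {S : Set Y} {F : ℝ → Y → X} {η C α : ℝ} (hη : 0 < η)
    (hα : 0 < α)
    (hH : ∀ s ∈ Ioo (-η) (0 : ℝ), ∀ t ∈ Ioo (-η) (0 : ℝ), ∀ x ∈ S,
      dist (F t x) (F s x) ≤ C * |t - s| ^ α) :
    ∀ ε > (0 : ℝ), ∃ δ > (0 : ℝ), ∀ s ∈ Ioo (-δ) (0 : ℝ), ∀ t ∈ Ioo (-δ) (0 : ℝ),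
      ∀ x ∈ S, dist (F t x) (F s x) < ε := by
  intro ε hε
  have h0 : Tendsto (fun r : ℝ => C * r ^ α) (𝓝 0) (𝓝 0) := by
    have h1 : Tendsto (fun r : ℝ => r ^ α) (𝓝 0) (𝓝 ((0 : ℝ) ^ α)) :=
      ((Real.continuous_rpow_const hα.le).tendsto 0)
    rw [Real.zero_rpow hα.ne'] at h1
    simpa using h1.const_mul C
  obtain ⟨δ₀, hδ₀, hδ₀'⟩ := Metric.tendsto_nhds_nhds.mp h0 ε hε
  refine ⟨min η (δ₀ / 2), lt_min hη (by linarith), ?_⟩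
  intro s hs t ht x hx
  have hmin : min η (δ₀ / 2) ≤ η := min_le_left _ _
  have hs' : s ∈ Ioo (-η) (0 : ℝ) := ⟨by linarith [hs.1], hs.2⟩
  have ht' : t ∈ Ioo (-η) (0 : ℝ) := ⟨by linarith [ht.1], ht.2⟩
  have hts : |t - s| < δ₀ := by
    have h2 : -(min η (δ₀ / 2)) < s := hs.1
    have h3 : -(min η (δ₀ / 2)) < t := ht.1
    have h4 : min η (δ₀ / 2) ≤ δ₀ / 2 := min_le_right _ _
    rw [abs_lt]; constructor <;> linarith [hs.2, ht.2]
  have h5 : dist (C * |t - s| ^ α) 0 < ε := hδ₀' (by simpa using hts)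
  calc dist (F t x) (F s x) ≤ C * |t - s| ^ α := hH s hs' t ht' x hx
    _ ≤ |C * |t - s| ^ α| := le_abs_self _
    _ = dist (C * |t - s| ^ α) 0 := by simp
    _ < ε := h5

/-- Uniformly Cauchy along `𝓝[<] 0` with complete target ⇒ a terminal trace exists. -/
theorem exists_tendstoUniformlyOn_nhdsLT_zero [CompleteSpace X] {S : Set Y} {F : ℝ → Y → X}
    (hF : UniformCauchySeqOn F (𝓝[<] (0 : ℝ)) S) :
    ∃ f : Y → X, TendstoUniformlyOn F f (𝓝[<] (0 : ℝ)) S := by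
  classical
  have hlim : ∀ x ∈ S, ∃ y : X, Tendsto (fun t => F t x) (𝓝[<] (0 : ℝ)) (𝓝 y) :=
    fun x hx => cauchy_map_iff_exists_tendsto.mp (hF.cauchy_map hx)
  choose! f hf using hlim
  exact ⟨f, hF.tendstoUniformlyOn_of_tendsto hf⟩

variable {E' : Type*} [NormedAddCommGroup E'] [NormedSpace ℝ E'] [NormedSpace ℝ X]

/-- Differentiability of the terminal trace: values and spatial derivatives converge uniformly on an open set,
differentiability only for `t` near `0⁻`. -/
theorem hasFDerivAt_terminalTrace {S : Set E'} (hS : IsOpen S) {F : ℝ → E' → X} {f : E' → X}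
    {g : E' → (E' →L[ℝ] X)}
    (hF : TendstoUniformlyOn F f (𝓝[<] (0 : ℝ)) S)
    (hF' : TendstoUniformlyOn (fun t => fderiv ℝ (F t)) g (𝓝[<] (0 : ℝ)) S)
    (hd : ∀ᶠ t in 𝓝[<] (0 : ℝ), DifferentiableOn ℝ (F t) S) :
    ∀ x ∈ S, HasFDerivAt f (g x) x := by
  intro x hx
  have hSx : S ∈ 𝓝 x := hS.mem_nhds hx
  have h1 : TendstoUniformlyOnFilter (fun t => fderiv ℝ (F t)) g (𝓝[<] (0 : ℝ)) (𝓝 x) :=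
    (tendstoUniformlyOn_iff_tendstoUniformlyOnFilter.mp hF').mono_right (le_principal_iff.mpr hSx)
  have hyS : ∀ᶠ y in 𝓝 x, y ∈ S := eventually_of_mem hSx fun y hy => hy
  have h2 : ∀ᶠ n : ℝ × E' in (𝓝[<] (0 : ℝ)) ×ˢ 𝓝 x,
      HasFDerivAt (F n.1) (fderiv ℝ (F n.1) n.2) n.2 := by
    filter_upwards [hd.prod_mk hyS] with n hn
    exact ((hn.1 n.2 hn.2).differentiableAt (hS.mem_nhds hn.2)).hasFDerivAt
  have h3 : ∀ᶠ y in 𝓝 x, Tendsto (fun n => F n y) (𝓝[<] (0 : ℝ)) (𝓝 (f y)) :=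
    hyS.mono fun y hy => hF.tendsto_at hy
  exact hasFDerivAt_of_tendstoUniformlyOnFilter h1 h2 h3

/-- The conclusion block of `TerminalTraceC1`, abstractly: moduli in time for `F` and for `fderiv ℝ (F t)` near `0⁻` on
an open set `S`, differentiability of `F t` on `S` for `t` near `0⁻` ⇒ a differentiable terminal trace with uniform
convergence of values and derivatives. -/
theorem exists_terminalTraceC1 [CompleteSpace X] {S : Set E'} (hS : IsOpen S) {F : ℝ → E' → X}
    (hC0 : ∀ ε > (0 : ℝ), ∃ δ > (0 : ℝ), ∀ s ∈ Ioo (-δ) (0 : ℝ), ∀ t ∈ Ioo (-δ) (0 : ℝ),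
      ∀ x ∈ S, dist (F t x) (F s x) < ε)
    (hC1 : ∀ ε > (0 : ℝ), ∃ δ > (0 : ℝ), ∀ s ∈ Ioo (-δ) (0 : ℝ), ∀ t ∈ Ioo (-δ) (0 : ℝ),
      ∀ x ∈ S, dist (fderiv ℝ (F t) x) (fderiv ℝ (F s) x) < ε)
    (hd : ∀ᶠ t in 𝓝[<] (0 : ℝ), DifferentiableOn ℝ (F t) S) :
    ∃ f : E' → X, DifferentiableOn ℝ f S ∧ TendstoUniformlyOn (fun t => F t) f (𝓝[<] (0 : ℝ)) S ∧
      TendstoUniformlyOn (fun t => fderiv ℝ (F t)) (fderiv ℝ f) (𝓝[<] (0 : ℝ)) S := by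
  obtain ⟨f, hf⟩ := exists_tendstoUniformlyOn_nhdsLT_zero (uniformCauchySeqOn_nhdsLT_zero hC0)
  obtain ⟨g, hg⟩ := exists_tendstoUniformlyOn_nhdsLT_zero
    (uniformCauchySeqOn_nhdsLT_zero (F := fun t => fderiv ℝ (F t)) hC1)
  have hder : ∀ x ∈ S, HasFDerivAt f (g x) x := hasFDerivAt_terminalTrace hS hf hg hd
  refine ⟨f, fun x hx => (hder x hx).differentiableAt.differentiableWithinAt, hf, ?_⟩
  exact hg.congr_right fun x hx => ((hder x hx).fderiv).symm

end Topology

/-! ## §2 The Navier–Stokes input: Hölder moduli in time up to the terminal slice (Seregin–Šverák 2009 §2, by name) -/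

/-- distance of iterated derivatives of order `0` is the distance of the values. -/
theorem dist_iteratedFDeriv_zero {E F : Type*} [NormedAddCommGroup E] [NormedSpace ℝ E] [NormedAddCommGroup F]
    [NormedSpace ℝ F] (f g : E → F) (x : E) :
    dist (iteratedFDeriv ℝ 0 f x) (iteratedFDeriv ℝ 0 g x) = dist (f x) (g x) := by
  rw [iteratedFDeriv_zero_eq_comp, iteratedFDeriv_zero_eq_comp, Function.comp_apply, Function.comp_apply,
    LinearIsometryEquiv.dist_map]

/-- distance of Fréchet derivatives is at most the distance of the iterated derivatives of order `1`. -/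
theorem dist_fderiv_le_dist_iteratedFDeriv_one {E F : Type*} [NormedAddCommGroup E] [NormedSpace ℝ E]
    [NormedAddCommGroup F] [NormedSpace ℝ F] (f g : E → F) (x : E) :
    dist (fderiv ℝ f x) (fderiv ℝ g x) ≤ dist (iteratedFDeriv ℝ 1 f x) (iteratedFDeriv ℝ 1 g x) := by
  rw [dist_eq_norm, dist_eq_norm]
  refine ContinuousLinearMap.opNorm_le_bound _ (norm_nonneg _) fun v => ?_
  have h : (fderiv ℝ f x - fderiv ℝ g x) v = (iteratedFDeriv ℝ 1 f x - iteratedFDeriv ℝ 1 g x) (fun _ => v) := by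
    rw [sub_apply, sub_apply, iteratedFDeriv_one_apply, iteratedFDeriv_one_apply]
  rw [h]
  refine (ContinuousMultilinearMap.le_opNorm _ _).trans (le_of_eq ?_)
  simp

/-- **Hölder moduli in time, uniformly up to the terminal slice, for `u` and `D_x u` on `B(x_c, 2r)`** — from
`NSBoundedHigherRegularityBounds_holds` (Seregin–Šverák 2009 §2: higher interior regularity of bounded distributional
solutions with the dependence of the norms on the data) applied on the backward parabolic cylinders `Q_{R₀}(0, x)`,
`R₀ = min r √(−a)`, with VERTEX AT THE TERMINAL TIME and centre `x ∈ B(x_c, 2r)` (all inside `(a,0) × B(x_c,4r)`); the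
constants are uniform in the centre.  The representative `V` is identified with `u` on the inner cylinder by joint
continuity (`Measure.eqOn_open_of_ae_eq`). -/
theorem holder_moduli_of_classical (xc : EuclideanSpace ℝ (Fin 3)) (r a M P : ℝ) (hr : 0 < r) (ha : a < 0)
    (u : ℝ → EuclideanSpace ℝ (Fin 3) → EuclideanSpace ℝ (Fin 3)) (p : ℝ → EuclideanSpace ℝ (Fin 3) → ℝ)
    (hsol : IsClassicalNSSolutionOnRegion (Ioo a 0 ×ˢ ball xc (4 * r)) 1 0 u p)
    (hu : ∀ t ∈ Ioo a 0, ∀ x ∈ ball xc (4 * r), ‖u t x‖ ≤ M)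
    (hp : ∀ t ∈ Ioo a 0, ∀ x ∈ ball xc (4 * r), |p t x| ≤ P) :
    ∃ η : ℝ, 0 < η ∧ ∃ C₀ α₀ C₁ α₁ : ℝ, 0 < α₀ ∧ 0 < α₁ ∧
      (∀ s ∈ Ioo (-η) (0 : ℝ), ∀ t ∈ Ioo (-η) (0 : ℝ), ∀ x ∈ ball xc (2 * r),
        dist (u t x) (u s x) ≤ C₀ * |t - s| ^ α₀) ∧
      (∀ s ∈ Ioo (-η) (0 : ℝ), ∀ t ∈ Ioo (-η) (0 : ℝ), ∀ x ∈ ball xc (2 * r),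
        dist (fderiv ℝ (u t) x) (fderiv ℝ (u s) x) ≤ C₁ * |t - s| ^ α₁) := by
  have hO : IsOpen (Ioo a 0 ×ˢ ball xc (4 * r)) := isOpen_Ioo.prod isOpen_ball
  -- the cylinder radius
  set R₀ : ℝ := min r (Real.sqrt (-a)) with hR₀_def
  have hsa : 0 < Real.sqrt (-a) := Real.sqrt_pos.2 (by linarith)
  have hR₀ : 0 < R₀ := lt_min hr hsa
  have hR₀r : R₀ ≤ r := min_le_left _ _
  have hR₀a : R₀ ^ 2 ≤ -a := by
    calc R₀ ^ 2 ≤ Real.sqrt (-a) ^ 2 := pow_le_pow_left₀ hR₀.le (min_le_right _ _) 2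
      _ = -a := Real.sq_sqrt (by linarith)
  set r' : ℝ := R₀ / 2 with hr'_def
  have hr' : r' ∈ Ioo 0 R₀ := ⟨by positivity, by rw [hr'_def]; linarith⟩
  -- the pressure data bound
  set X : ℝ≥0∞ := ENNReal.ofReal P ^ (3 / 2 : ℝ) *
    (volume (Ioo (-(R₀ ^ 2)) (0 : ℝ)) * volume (ball (0 : EuclideanSpace ℝ (Fin 3)) R₀)) with hX_def
  have hXtop : X ≠ ⊤ := by
    refine ENNReal.mul_ne_top (ENNReal.rpow_ne_top_of_nonneg (by norm_num) ENNReal.ofReal_ne_top)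
      (ENNReal.mul_ne_top ?_ measure_ball_lt_top.ne)
    rw [Real.volume_Ioo]; exact ENNReal.ofReal_ne_top
  set P' : ℝ≥0 := X.toNNReal with hP'_def
  have hP'X : (P' : ℝ≥0∞) = X := ENNReal.coe_toNNReal hXtop
  obtain ⟨K, C, α, hα, H⟩ := NSBoundedHigherRegularityBounds_holds R₀ M P'
  -- the representative on the cylinder with vertex `(0, x)`
  have key : ∀ x ∈ ball xc (2 * r), ∃ V : ℝ → EuclideanSpace ℝ (Fin 3) → EuclideanSpace ℝ (Fin 3),
      (∀ t ∈ Ioo (-(r' ^ 2)) (0 : ℝ), ∀ y ∈ ball x r', u t y = V t y) ∧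
      (∀ n : ℕ, HolderOnWith (C n r') (α n r') (fun w : ℝ × EuclideanSpace ℝ (Fin 3) => iteratedFDeriv ℝ n (V w.1) w.2)
        (parabolicCylinder r' ((0 : ℝ), x))) := by
    intro x hx
    rw [mem_ball] at hx
    set z : ℝ × EuclideanSpace ℝ (Fin 3) := ((0 : ℝ), x) with hz_def
    have hQO : parabolicCylinder R₀ z ⊆ Ioo a 0 ×ˢ ball xc (4 * r) := by
      rintro ⟨t, y⟩ hw
      rw [mem_parabolicCylinder] at hw
      obtain ⟨⟨ht1, ht2⟩, hy⟩ := hw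
      simp only [hz_def, zero_sub] at ht1 ht2 hy
      refine mk_mem_prod ⟨by linarith, ht2⟩ ?_
      rw [mem_ball]
      calc dist y xc ≤ dist y x + dist x xc := dist_triangle _ _ _
        _ < R₀ + 2 * r := by linarith
        _ ≤ 4 * r := by linarith
    have hdist : IsDistributionalNSSolutionOn (parabolicCylinderOpens R₀ z) 1 0 u p :=
      hsol.isDistributionalNSSolutionOn hO (by simpa using hQO)
    have hbd : ∀ᵐ w ∂(volume.restrict (parabolicCylinder R₀ z)), ‖u w.1 w.2‖ ≤ M :=
      ae_restrict_of_forall_mem (isOpen_parabolicCylinder _ _).measurableSet fun w hw => by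
        have hw' := hQO hw
        rw [mem_prod] at hw'
        exact hu w.1 hw'.1 w.2 hw'.2
    have hpP : ∫⁻ w in parabolicCylinder R₀ z, ‖p w.1 w.2‖ₑ ^ (3 / 2 : ℝ) ≤ P' := by
      have hvol : volume (parabolicCylinder R₀ z) =
          volume (Ioo (-(R₀ ^ 2)) (0 : ℝ)) * volume (ball (0 : EuclideanSpace ℝ (Fin 3)) R₀) := by
        rw [parabolicCylinder, Measure.volume_eq_prod, Measure.prod_prod, hz_def, zero_sub,
          Measure.addHaar_ball_center]
      rw [hP'X, hX_def, ← hvol]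
      calc ∫⁻ w in parabolicCylinder R₀ z, ‖p w.1 w.2‖ₑ ^ (3 / 2 : ℝ)
          ≤ ∫⁻ _ in parabolicCylinder R₀ z, ENNReal.ofReal P ^ (3 / 2 : ℝ) := by
            refine setLIntegral_mono' (isOpen_parabolicCylinder _ _).measurableSet fun w hw => ?_
            have hw' := hQO hw
            rw [mem_prod] at hw'
            have h1 : ‖p w.1 w.2‖ₑ ≤ ENNReal.ofReal P := by
              rw [Real.enorm_eq_ofReal_abs]
              exact ENNReal.ofReal_le_ofReal (hp w.1 hw'.1 w.2 hw'.2)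
            exact ENNReal.rpow_le_rpow h1 (by norm_num)
        _ = ENNReal.ofReal P ^ (3 / 2 : ℝ) * volume (parabolicCylinder R₀ z) := setLIntegral_const _ _
    obtain ⟨V, hae, -, hH⟩ := H u p z hdist hbd hpP
    refine ⟨V, ?_, fun n => (hH n r' hr').1⟩
    -- identification `u = V` on the inner cylinder by joint continuity
    have hsub : parabolicCylinder r' z ⊆ parabolicCylinder R₀ z := by
      rintro ⟨t, y⟩ hw
      rw [mem_parabolicCylinder] at hw ⊢
      obtain ⟨⟨ht1, ht2⟩, hy⟩ := hw
      have h1 : r' ^ 2 ≤ R₀ ^ 2 := pow_le_pow_left₀ hr'.1.le hr'.2.le 2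
      exact ⟨⟨by linarith, ht2⟩, hy.trans hr'.2⟩
    have hcontu : ContinuousOn (uncurry u) (parabolicCylinder r' z) :=
      hsol.smooth_velocity.continuousOn.mono (hsub.trans hQO)
    have hcontV : ContinuousOn (uncurry V) (parabolicCylinder r' z) := by
      have h0 := (hH 0 r' hr').1.continuousOn (hα 0 r' hr')
      have heq : uncurry V = (continuousMultilinearCurryFin0 ℝ (EuclideanSpace ℝ (Fin 3)) (EuclideanSpace ℝ (Fin 3))) ∘
          (fun w : ℝ × EuclideanSpace ℝ (Fin 3) => iteratedFDeriv ℝ 0 (V w.1) w.2) := by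
        funext w
        simp only [Function.comp_apply, iteratedFDeriv_zero_eq_comp, LinearIsometryEquiv.apply_symm_apply]
        rfl
      rw [heq]
      exact (LinearIsometryEquiv.continuous _).comp_continuousOn h0
    have hae' : uncurry u =ᵐ[volume.restrict (parabolicCylinder r' z)] uncurry V :=
      ae_restrict_of_ae_restrict_of_subset hsub hae
    have heqOn := Measure.eqOn_open_of_ae_eq hae' (isOpen_parabolicCylinder _ _) hcontu hcontV
    intro t ht y hy
    have hmem : (t, y) ∈ parabolicCylinder r' z := by
      rw [mem_parabolicCylinder]
      refine ⟨⟨by simpa [hz_def] using ht.1, by simpa [hz_def] using ht.2⟩, by simpa [hz_def] using hy⟩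
    exact heqOn hmem
  -- the moduli
  have hpt : ∀ x : EuclideanSpace ℝ (Fin 3), ∀ s ∈ Ioo (-(r' ^ 2)) (0 : ℝ), ∀ t ∈ Ioo (-(r' ^ 2)) (0 : ℝ),
      (s, x) ∈ parabolicCylinder r' ((0 : ℝ), x) ∧ (t, x) ∈ parabolicCylinder r' ((0 : ℝ), x) ∧
      dist ((t, x) : ℝ × EuclideanSpace ℝ (Fin 3)) (s, x) = |t - s| := by
    intro x s hs t ht
    refine ⟨?_, ?_, ?_⟩
    · rw [mem_parabolicCylinder]; exact ⟨⟨by simpa using hs.1, by simpa using hs.2⟩, by simpa using hr'.1⟩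
    · rw [mem_parabolicCylinder]; exact ⟨⟨by simpa using ht.1, by simpa using ht.2⟩, by simpa using hr'.1⟩
    · rw [Prod.dist_eq, dist_self, max_eq_left dist_nonneg, Real.dist_eq]
  refine ⟨r' ^ 2, by nlinarith [hr'.1], C 0 r', α 0 r', C 1 r', α 1 r', hα 0 r' hr', hα 1 r' hr', ?_, ?_⟩
  · intro s hs t ht x hx
    obtain ⟨V, hVeq, hVH⟩ := key x hx
    obtain ⟨hsQ, htQ, hd⟩ := hpt x s hs t ht
    have hxr : x ∈ ball x r' := mem_ball_self hr'.1
    rw [hVeq t ht x hxr, hVeq s hs x hxr, ← dist_iteratedFDeriv_zero]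
    have h := (hVH 0).dist_le htQ hsQ
    rwa [hd] at h
  · intro s hs t ht x hx
    obtain ⟨V, hVeq, hVH⟩ := key x hx
    obtain ⟨hsQ, htQ, hd⟩ := hpt x s hs t ht
    have hfd : ∀ τ ∈ Ioo (-(r' ^ 2)) (0 : ℝ), fderiv ℝ (u τ) x = fderiv ℝ (V τ) x := by
      intro τ hτ
      refine Filter.EventuallyEq.fderiv_eq ?_
      filter_upwards [ball_mem_nhds x hr'.1] with y hy
      exact hVeq τ hτ y hy
    rw [hfd t ht, hfd s hs]
    refine (dist_fderiv_le_dist_iteratedFDeriv_one _ _ _).trans ?_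
    have h := (hVH 1).dist_le htQ hsQ
    rwa [hd] at h

/-! ## §3 PF-a by name -/

/-- **PF-a · `TerminalTraceC1` holds**: a classical solution bounded with bounded pressure on `(a,0) × B(x_c,4r)` has a
terminal velocity trace `u₀` on `B(x_c,2r)`, differentiable, with `u t → u₀` and `D_x u t → D_x u₀` uniformly as
`t ↑ 0` (Hölder moduli in time from Seregin–Šverák's interior regularity on backward cylinders with vertex at the
terminal time, §2, + the abstract trace lemma `exists_terminalTraceC1`, §1). -/
theorem terminalTraceC1_holds : TerminalTraceC1 := by
  intro xc r a M P hr ha hM hP u p hsol hu hp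
  obtain ⟨η, hη, C₀, α₀, C₁, α₁, hα₀, hα₁, h0, h1⟩ := holder_moduli_of_classical xc r a M P hr ha u p hsol hu hp
  have hd : ∀ᶠ t in 𝓝[<] (0 : ℝ), DifferentiableOn ℝ (u t) (ball xc (2 * r)) := by
    filter_upwards [Ioo_mem_nhdsLT ha] with t ht
    have h := (hsol.contDiffOn_velocity t).differentiableOn (by simp)
    rw [spaceSection_prod ht] at h
    exact h.mono (ball_subset_ball (by linarith))
  exact exists_terminalTraceC1 isOpen_ball (epsDelta_of_holder_time hη hα₀ h0) (epsDelta_of_holder_time hη hα₁ h1) hd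

end Summit.NavierStokesRegularity.NavierStokesRegularity.Theorems.QuietScarPocketDoor

end
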